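import Summits.BirchSwinnertonDyer.Rank1Residual.X11b.RouteP2OpenInputFromPrint
import Summits.BirchSwinnertonDyer.Rank1Residual.X11b.BDPRouteSelmerCardBoundTorsion
import Summits.BirchSwinnertonDyer.Rank1Residual.X11b.BDPRouteWholeClassOnTree
import Literature.FieldTheory.AlgClosed.PadicAlgClEquivComplex
import HarnessLib

/-!
# Class X11b, route p2 at `p ≥ 5`: the `Ω_K = 0` DEGENERATE FRAME — the gen-23 ∀-shape
# `P2.IMCDivOnTree` (no binder `Ω_K ≠ 0`) forces `Ch_Λ(X_ac) = ⊥` and is REFUTABLE under the cell's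
# published facts (cell `b2b-bsdres`, sub-cell `multr1-p2`, gen 26)

HONEST FRAMING (cell `b2b-bsdres`, run/shared/lean/b2b/bsd-rank1-residual/, verbatim in every
file): the goal of the cell is to DELETE the COMBINATION-SHAPED residual classes of the
Birch–Swinnerton-Dyer formula for ALL analytic-rank `≤ 1` elliptic curves over `ℚ` — "full BSD
formula for every rank `≤ 1` curve in class `C`" assembled STRICTLY from published theorems — so
that the rank-`≤ 1` remainder becomes exactly the CONSTRUCTION-SHAPED classes, which are TYPED
(missing-input `Prop`s), NOT attempted. This is not "finishing BSD". Sub-cell `multr1-p2` is a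
RESEARCH ROUTE on class X11b (`ClassX11b W p := r_an = 1 ∧ p ≠ 2 ∧ mult(p) ∧ irr(p)`,
`Partition/Rows.lean`); no claim beyond the stated class and loci; X11b's label does not change;
NOTHING is booked by this file.

THEOREMS ONLY (one of them NEGATIVE, about a superseded TYPED SHAPE — not about any published
statement); no definition, no named fact, no `sorry`.

## Why this file (honest-typing finding, gen 26)

The Literature predicate `IsBDPLFunction ι 𝔭 κ γ f Ω_K Ω_p L` (Castella 2018 Thm. 3.1 as a
characterising predicate) does not enforce `Ω_K ≠ 0` ("meant: `Ω_K ≠ 0`", its docstring), and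
Castella's display divides by `Ω_K^{4n}`: with Lean's `x / 0 = 0` the pair `(Ω_K, L) = (0, 0)`
SATISFIES the predicate (`isBDPLFunction_zero_zero`). A ∀-frame shape that omits `Ω_K ≠ 0` therefore
demands its conclusion of `L = 0`. Gen 23's `P2.IMCDivOnTree W p` (`X11b/RouteP2OpenInputFromPrint.lean`:
"for every frame `(Ω_K, Ω_p, L)` with `IsBDPLFunction …`: `Ch_Λ(X_ac)·R₀⟦T⟧ ⊆ (L)`") is such a shape:

* **`P2.charIdeal_eq_bot_of_imcDivOnTree`** — it forces `Ch_Λ(X_ac^∅(E[p^∞])) = ⊥` at every datum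
  (degenerate frame at `f = f_{Dt}`, pull back along the injective `Λ → R₀⟦T⟧`,
  `map_toUnr_injective`);
* **`P2.not_imcDivOnTree_of_facts`** — hence `¬ P2.IMCDivOnTree W p` for every `(E,p) ∈` X11b with
  `p ≥ 5` and `ρ̄` onto, given Kolyvagin, Poitou–Tate, the local Euler characteristic (the ONE-SIDED
  CONTROL theorem `p2ControlUpperOnTreeAt_of_facts`: `X_ac` torsion with `f_ac(0) ≠ 0`), and
  Gross–Zagier, modularity ×2, Hoffstein–Luo, Mazur (NON-VACUITY of the data,
  `exists_onTreeInput_antecedents_of_classX11b`; an embedding datum `ι' : ℚ̄_p ≃ ℂ` exists by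
  `PadicAlgCl.nonempty_ringEquiv_complex`).

CONSEQUENCE (bookkeeping only; no mark, no label): the gen-23 records consuming `P2.IMCDivOnTree`
(`P2.openInputOnTreeAt_of_imcDiv_of_facts` / `…_of_controlUpper`, `P2.bsdp_of_semistable_of_imcDiv`,
`P2.bsdp_of_locus_of_imcDiv`, and their `R1`-side callers if any) are TRUE but VACUOUSLY conditional
on surjective pairs. They were superseded in gens 24–25 by the ♭-records over
`P2.IMCDivIntFrameOnTree` / `P2.IMCDivSomeFrameOnTree`, whose ∃-frames carry `Ω_K ≠ 0` — the
wording of record is NOT affected. The corrected print-currency ∀-shape (binder `Ω_K ≠ 0`, as in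
x11b3's `Three.IMCDivAt₃`) is `P2.IMCDivAllUnrFramesOnTree` (`X11b/BDPRouteOpenInputDescent.lean`).
Route R1's gen-21 ∀-shapes `R1.IMCEqOnTree` / `R1.BDPValueOnTree` quantify over the same degenerate
frame; flagged to multr1-p1 (HOME/INBOX.md), not touched here.

References: [Castella2018] Thm. 2.3, Thm. 3.1 (arXiv:1704.06608 pp. 5, 9); [Castella2018Erratum] (2.4).
-/

noncomputable section

open scoped Classical Topology NumberField

open Filter WeierstrassCurve NumberField IsDedekindDomain Field PowerSeries
open Literature.NumberTheory.EllipticCurves Literature.NumberTheory.EllipticCurves.GreenbergSelmer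
open Literature.NumberTheory.EllipticCurves.ModularForms
open Literature.NumberTheory.EllipticCurves.Rank1Residual
open Literature.NumberTheory.EllipticCurves.Rank1Residual.Typed
open Literature.NumberTheory.EllipticCurves.Castella2018
open Literature.NumberTheory.QuadraticFields.Quadratic
open Literature.NumberTheory.GaloisRepresentations Literature.NumberTheory.GaloisCohomology
open Summit.BirchSwinnertonDyer.Rank1Residual.X11b.AcSelmer
open Summit.BirchSwinnertonDyer.Rank1Residual.X11b.Halves

namespace Summit.BirchSwinnertonDyer.Rank1Residual.X11b

/-! ### §1 Injectivity of `Λ → Λ_{R₀}` -/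

section Injective

variable {p : ℕ} [Fact p.Prime]

/-- The structure map `ℤ_p → R₀` is injective. [folklore] -/
theorem toUnr_injective : Function.Injective (toUnr p) := fun a b hab ↦ by
  have h := congrArg (fun z : unrIntegers p ↦ (z : ℂ_[p])) hab
  simp only [coe_toUnr] at h
  exact Subtype.ext ((algebraMap ℚ_[p] ℂ_[p]).injective h)

/-- `Λ = ℤ_p⟦T⟧ → R₀⟦T⟧` is injective. [folklore] -/
theorem map_toUnr_injective :
    Function.Injective (PowerSeries.map (toUnr p) : IwasawaAlgebra p → UnrSeries p) :=
  fun a b hab ↦ PowerSeries.ext fun n ↦ toUnr_injective (by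
    simpa only [PowerSeries.coeff_map] using congrArg (PowerSeries.coeff n) hab)

end Injective

/-! ### §2 The degenerate frame `(Ω_K, L) = (0, 0)` and the refutation of gen 23's `P2.IMCDivOnTree` -/

section Degenerate

variable {p : ℕ} [Fact p.Prime] {K : Type} [Field K] [NumberField K] {N : ℕ}

/-- **The degenerate frame**: with `Ω_K = 0` Castella's display `… / (π^{2n+1}·Ω_K^{4n})` is `0` in
Lean (`x / 0 = 0`, `4n > 0`), so the ZERO series satisfies the Literature predicate
`IsBDPLFunction ι' 𝔭 κ γ f 0 Ω_p 0` for every `Ω_p`. (The predicate "means" `Ω_K ≠ 0` — its docstring —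
but does not enforce it; ∀-frame shapes must carry the binder `Ω_K ≠ 0`.)
[cite: Castella2018, Thm. 3.1 (arXiv:1704.06608 p. 9) (shape of the display)] -/
theorem isBDPLFunction_zero_zero (ι' : PadicAlgCl p ≃+* ℂ) (𝔭 : HeightOneSpectrum (𝓞 K))
    (κ : ZpExtension K p) (γ : Field.absoluteGaloisGroup K) (f : CuspForm (CongruenceSubgroup.Gamma0 N) 2)
    (Ωp : ℂ_[p]) : IsBDPLFunction ι' 𝔭 κ γ f 0 Ωp 0 := by
  intro φ n hn _ _ r _ _
  have hval : bdpInterpolationValue p f 𝔭 φ n 0 = 0 := by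
    unfold bdpInterpolationValue
    simp [zero_pow (show 4 * n ≠ 0 by omega)]
  rw [hval, map_zero]
  unfold UnrSeries.HasValueAt
  simp

variable {W : WeierstrassCurve ℚ} [W.IsElliptic] [W.IsGloballyMinimal]

omit [W.IsElliptic] [W.IsGloballyMinimal] in
/-- **Gen 23's ∀-shape `P2.IMCDivOnTree` FORCES `Ch_Λ(X_ac^∅(E[p^∞])) = ⊥` at every datum** (apply it
to the degenerate frame `(Ω_K, Ω_p, L) = (0, 1, 0)` at `f = f_{Dt}`, and pull `⊆ (0) = ⊥` back along the
injective `Λ → R₀⟦T⟧`). [cite: Castella2018, Thm. 3.1 (arXiv:1704.06608 p. 9) (shape of the display)] -/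
theorem P2.charIdeal_eq_bot_of_imcDivOnTree (h : P2.IMCDivOnTree W p) (N : ℕ) [NeZero N]
    (K : Type) [Field K] [NumberField K] (Dt : ModularParametrizationData W N)
    (H : HeegnerDatum N (NumberField.discr K)) (ι : K →+* ℂ) (P : (W.baseChange K).toAffine.Point)
    (hX : ClassX11b W p) (h5 : 5 ≤ p) (hs : Surj W p) (hN : W.conductorNorm ℤ = N)
    (hK : IsImaginaryQuadratic K) (hodd : Odd (NumberField.discr K))
    (hpd : ¬ (p : ℤ) ∣ NumberField.discr K) (hμ : ¬ p ∣ Units.torsionOrder K)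
    (hHN : SatisfiesHeegnerHypothesis N K)
    (hLt : (W.quadraticTwist (NumberField.discr K : ℚ)).entireLFunction 1 ≠ 0)
    (hP : WeierstrassCurve.Affine.Point.map ι.toRatAlgHom P = heegnerPointComplex Dt H)
    (hc : ¬ (p : ℤ) ∣ Dt.c) (hPinf : ¬ IsOfFinAddOrder P) (κ : ZpExtension K p)
    (hκ : κ.IsAnticyclotomic) (γ : Field.absoluteGaloisGroup K) [Fact (κ.IsTopGenerator γ)]
    (ι' : PadicAlgCl p ≃+* ℂ) (w₀ : InfinitePlace K) :
    XAc.charIdeal (W.baseChange K) p κ (primeOfEmbeddingDatum p ι' w₀.embedding) ∅ γ = ⊥ := by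
  have hle := h N K Dt H ι P hX h5 hs hN hK hodd hpd hμ hHN hLt hP hc hPinf κ hκ γ Dt.f Dt.isNewformOf
    ι' w₀ 0 1 0 (isBDPLFunction_zero_zero ι' _ κ γ Dt.f _)
  rw [Ideal.span_singleton_eq_bot.mpr rfl, le_bot_iff,
    Ideal.map_eq_bot_iff_of_injective map_toUnr_injective] at hle
  exact hle

/-- **`P2.IMCDivOnTree W p` is REFUTABLE on every X11b pair with `p ≥ 5` and `ρ̄` onto, given the
cell's standard published facts.** The data of the shape EXIST at the pair
(`exists_onTreeInput_antecedents_of_classX11b`: Gross–Zagier, modularity ×2, Hoffstein–Luo, Mazur,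
Néron scaling — the last a tree theorem), an embedding datum `ι' : ℚ̄_p ≃ ℂ` exists
(`PadicAlgCl.nonempty_ringEquiv_complex`), and at the induced degree-one prime `𝔭_{ι'}` the ONE-SIDED
CONTROL theorem (`p2ControlUpperOnTreeAt_of_facts`: Kolyvagin, Poitou–Tate, local Euler characteristic)
says `X_ac` is `Λ`-torsion with `Ch_Λ(X_ac) = (f_ac)`, `f_ac(0) ≠ 0` — contradicting
`P2.charIdeal_eq_bot_of_imcDivOnTree`. HONEST CONSEQUENCE: the gen-23 records consuming
`P2.IMCDivOnTree` are vacuously conditional on these pairs; the records of the current wording (over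
`P2.IMCDivSomeFrameOnTree`, ∃-frames with `Ω_K ≠ 0`) are unaffected; the corrected ∀-shape is
`P2.IMCDivAllUnrFramesOnTree`. A NEGATIVE theorem about a TYPED SHAPE, not about any published
statement: the erratum's (2.4) concerns Castella's `L_p(f)` with `Ω_K ≠ 0`.
[cite: Castella2018, Thm. 2.3 (arXiv:1704.06608 p. 5)] [cite: Kolyvagin1990, Thm. A]
[cite: MilneADT2006, Ch. I, Thm. 4.10(b) and Thm. 2.8] [cite: GrossZagier1986, Thm. I.(6.3)]
[cite: HoffsteinLuo1997, Theorem (§1, pp. 435–436)] [cite: Mazur1978, Cor. 4.1] -/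
theorem P2.not_imcDivOnTree_of_facts
    (hKo : ∀ (N : ℕ) [NeZero N] (W : WeierstrassCurve ℚ) (K : Type) [Field K] [NumberField K],
      kolyvagin N W K)
    (hPT : ∀ (K : Type) [Field K] [NumberField K], poitouTate_sum_localTatePairing_eq_zero K)
    (hEP : ∀ (K : Type) [Field K] [NumberField K] (v : HeightOneSpectrum (𝓞 K)),
      localEulerPoincareCharacteristic (v.adicCompletion K))
    (hGZ : ∀ (N : ℕ) [NeZero N] (W : WeierstrassCurve ℚ) (K : Type) [Field K] [NumberField K],
      gross_zagier N W K)
    (hmod : hasEntireLFunction_rat) (hnf : exists_isNewformOf)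
    (hHL : HoffsteinLuo1997_exists_twist_L_one_ne_zero) (hMaz : mazur_not_dvd_maninConstant_of_odd)
    (hX : ClassX11b W p) (h5 : 5 ≤ p) (hs : Surj W p) : ¬ P2.IMCDivOnTree W p := by
  intro h
  obtain ⟨_, K, _, _, Dt, H, ι, P, κ, γ, -, hK, hodd, hpd, hμ, hHN, hLt, hP, hc, hPinf, hκ, hγ, -⟩ :=
    exists_onTreeInput_antecedents_of_classX11b hGZ hmod hnf hHL hMaz
      integral_neronScaling_of_isGloballyMinimal_holds W p hX
  haveI : Fact (κ.IsTopGenerator γ) := ⟨hγ⟩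
  obtain ⟨ι'⟩ := PadicAlgCl.nonempty_ringEquiv_complex p
  obtain ⟨w₀⟩ := (inferInstance : Nonempty (InfinitePlace K))
  have h𝔭 : ((p : ℕ) : 𝓞 K) ∈ (primeOfEmbeddingDatum p ι' w₀.embedding).asIdeal :=
    natCast_mem_primeOfEmbeddingDatum p ι' w₀.embedding
  have hsplit : SplitsIn K p := hHN p Fact.out (dvd_conductorNorm_of_mult hX.2.2.1)
  obtain ⟨he, hf⟩ := degreeOne_of_splitsIn hK.1 hsplit h𝔭
  obtain ⟨n, hn, -⟩ := p2ControlUpperOnTreeAt_of_facts W p hKo hPT hEP _ K Dt H ι P hX h5 hs rfl hK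
    hodd hpd hμ hHN hLt hP hc hPinf κ hκ γ _ h𝔭 he hf
  obtain ⟨-, g, hg, hg0, -⟩ := hn
  have hbot := P2.charIdeal_eq_bot_of_imcDivOnTree h _ K Dt H ι P hX h5 hs rfl hK hodd hpd hμ hHN hLt
    hP hc hPinf κ hκ γ ι' w₀
  rw [hg, Ideal.span_singleton_eq_bot] at hbot
  exact hg0 (by rw [hbot, map_zero])

end Degenerate

end Summit.BirchSwinnertonDyer.Rank1Residual.X11b

end
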